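import Mathlib
import Literature.Computability.Complexity.GraphEncodings
import Literature.Computability.Complexity.SymmetricCircuit
import Literature.Computability.Complexity.FoldCatBricks
import Literature.Computability.Complexity.UnaryOffsets
import Literature.Computability.Complexity.UnaryBricks
import Literature.Computability.Complexity.FPStringBricks
import Literature.Computability.Complexity.PlumbingBricks
import Literature.Computability.Complexity.Classes
import Literature.Computability.Complexity.SparseSetsUpwardSeparationNE
import Literature.Computability.Complexity.KarpChromaticMachine
import Literature.Computability.Complexity.TFNPProblems
import Summits.PneNP.PneNP.Theorems.SymmetryBudgetWindowBarrierRankDict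
import Summits.PneNP.PneNP.Theorems.SymmetryBudgetWindowBarrierExtractBricks
import Summits.PneNP.PneNP.Theorems.SymmetryBudgetWindowBarrierExtractBricks2
import Summits.PneNP.PneNP.Theorems.SymmetryBudgetWindowBarrierGraphBridge

/-!
# Stub `stub_completeInvariantFP_of_canonicalForm` of line `canonical-form-completeness` for crux
`SymmetryBudget.WindowBarrier` (item stmt-PneNP-2145, route route-PneNP-SymmetryBudget)

**From canonical forms of small vertex-coloured graphs to a polynomial-time complete invariant for
`Bud`-isomorphism.** Hypothesis (Babai–Luks 1983, stated over the tree's codes): a string map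
`can ∈ FTIME (N ↦ 2^{c√N})` returning, on the code `⟨encodingGraph.encode ⟨k, G⟩, encodingFinVec-code of col⟩`
of a vertex-coloured graph, the code of a colour-isomorphic coloured graph, with equal values on
colour-isomorphic inputs. Conclusion: some `F ∈ FP` satisfies, for all `m` and all `m × m` Boolean
matrices `x, y`, `F (code (Gr x)) = F (code (Gr y)) ↔ ∃ ρ ∈ pointStabiliserBudget m ⌊log₂ m⌋` carrying
`Gr x` onto `Gr y` (`Gr x = SimpleGraph.fromRel (x · · = true)`).

The witness is `F = invFn can` of `SymmetryBudgetWindowBarrierExtractBricks2.lean`: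
`F w = ⟨⟨fixed block, attachment dictionary⟩, can (code of the rank-coloured free graph)⟩`, where the
last `g = ⌊log₂ m⌋` vertices are free, a free vertex is coloured by the RANK of its attachment vector
(its row restricted to the `n = m - g` ordered vertices) and the dictionary lists, per rank, the vector.
`F ∈ FP`: the extraction is brick algebra and `can` runs on a string of length `≤ (3 (log₂|w| + 1))²`, i.e.
for `2^{3c (log₂|w|+1)} = poly(|w|)` steps (`invFn_mem_FP`). Completeness (`invFn_codeOf_eq_iff`):
(⇐) a budget permutation restricts to a rank-preserving isomorphism of the free graphs and fixes the
fixed block and the dictionary (`transfer_of_budget`, `rankFam_perm`, `lookupFam_perm`); (⇒) equal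
`can`-values give (hypothesis + injectivity of the codes) a rank-preserving isomorphism `τ` of the free
graphs, equal dictionaries upgrade rank-preservation to preservation of attachment vectors
(`lookupFam_rankFam`), and `τ` extends by the identity to a budget permutation (`budget_of_transfer`).
-/

-- `Summit.PneNP.PneNP.…` duplicates `PneNP` BY DESIGN (single-problem summit).
set_option linter.dupNamespace false

namespace Summit.PneNP.PneNP.Theorems

open Literature.Computability.Complexity Filter Brick
open _root_.Computability
open scoped Classical
open CompleteInvariant

namespace CompleteInvariant

variable {m : ℕ}

/-- **Codes of coloured graphs are injective**: equal codes `⟨encodingGraph-code, colour-code⟩` come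
from equal graphs and equal colourings. -/
theorem colouredCode_inj {k : ℕ} {G G' : SimpleGraph (Fin k)} {c c' : Fin k → ℕ}
    (h : boolPair (encodingGraph.encode ⟨k, G⟩) ((encodingFinVec encodingNatBool k).encode c) =
      boolPair (encodingGraph.encode ⟨k, G'⟩) ((encodingFinVec encodingNatBool k).encode c')) :
    G = G' ∧ c = c' := by
  have hp : encodingGraph.encode ⟨k, G⟩ = encodingGraph.encode ⟨k, G'⟩ ∧
      (encodingFinVec encodingNatBool k).encode c = (encodingFinVec encodingNatBool k).encode c' := by
    simpa [boolUnpair_boolPair] using congrArg boolUnpair h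
  refine ⟨?_, (encodingFinVec encodingNatBool k).encode_injective hp.2⟩
  have hs := encodingGraph.encode_injective hp.1
  simp only [Sigma.mk.injEq, heq_eq_eq, true_and] at hs
  exact hs

/-- **Completeness of the invariant.** For a map `can` with the two properties of the canonical-form
hypothesis, `invFn can` takes equal values on the codes of `G₁`, `G₂` iff some budget permutation
carries `G₁` onto `G₂`. -/
theorem invFn_codeOf_eq_iff {can : List Bool → List Bool}
    (h₁ : ∀ (k : ℕ) (G : SimpleGraph (Fin k)) (col : Fin k → ℕ),
      ∃ (G' : SimpleGraph (Fin k)) (col' : Fin k → ℕ),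
        can (boolPair (encodingGraph.encode ⟨k, G⟩) ((encodingFinVec encodingNatBool k).encode col)) =
          boolPair (encodingGraph.encode ⟨k, G'⟩) ((encodingFinVec encodingNatBool k).encode col') ∧
        ∃ σ : G ≃g G', ∀ v : Fin k, col' (σ v) = col v)
    (h₂ : ∀ (k : ℕ) (G₁ : SimpleGraph (Fin k)) (c₁ : Fin k → ℕ) (G₂ : SimpleGraph (Fin k)) (c₂ : Fin k → ℕ),
      (∃ σ : G₁ ≃g G₂, ∀ v : Fin k, c₂ (σ v) = c₁ v) →
        can (boolPair (encodingGraph.encode ⟨k, G₁⟩) ((encodingFinVec encodingNatBool k).encode c₁)) =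
          can (boolPair (encodingGraph.encode ⟨k, G₂⟩) ((encodingFinVec encodingNatBool k).encode c₂)))
    (G₁ G₂ : SimpleGraph (Fin m)) :
    invFn can (codeOf G₁) = invFn can (codeOf G₂) ↔
      ∃ ρ ∈ pointStabiliserBudget m (gg m), ∀ u v, G₂.Adj u v ↔ G₁.Adj (ρ u) (ρ v) := by
  have hlen₁ : ∀ i, i < gg m → (attOf (codeOf G₁) i).length = nn m := fun i _ => length_attOf_codeOf G₁ i
  have hlen₂ : ∀ i, i < gg m → (attOf (codeOf G₂) i).length = nn m := fun i _ => length_attOf_codeOf G₂ i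
  rw [invFn_apply, invFn_apply]
  constructor
  · intro h
    have hbp : ∀ {a b a' b' : List Bool}, boolPair a b = boolPair a' b' → a = a' ∧ b = b' := fun e => by
      simpa [boolUnpair_boolPair] using congrArg boolUnpair e
    obtain ⟨hfd, hcanEq⟩ := hbp h
    obtain ⟨hfix, hdict⟩ := hbp hfd
    rw [extractFn_codeOf, extractFn_codeOf] at hcanEq
    obtain ⟨G', col', e₁, σ₁, hσ₁⟩ := h₁ (gg m) (freeG G₁) (rkOf G₁)
    obtain ⟨G'', col'', e₂, σ₂, hσ₂⟩ := h₁ (gg m) (freeG G₂) (rkOf G₂)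
    rw [e₁, e₂] at hcanEq
    obtain ⟨rfl, rfl⟩ := colouredCode_inj hcanEq
    -- the rank-preserving isomorphism of the free graphs
    set τ : freeG G₁ ≃g freeG G₂ := σ₁.trans σ₂.symm with hτ
    have hrk : ∀ j, rkOf G₂ (τ j) = rkOf G₁ j := fun j => by
      have := hσ₂ (σ₂.symm (σ₁ j))
      rw [RelIso.apply_symm_apply] at this
      show rkOf G₂ (σ₂.symm (σ₁ j)) = rkOf G₁ j
      rw [← this, hσ₁]
    have hiso : ∀ a b, (freeG G₂).Adj (τ.toEquiv a) (τ.toEquiv b) ↔ (freeG G₁).Adj a b := fun a b => τ.map_adj_iff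
    -- dictionaries
    rw [dictFn_codeOf, dictFn_codeOf] at hdict
    have hlook : ∀ r, r < gg m →
        lookupFam (attOf (codeOf G₁)) (gg m) (nn m) r = lookupFam (attOf (codeOf G₂)) (gg m) (nn m) r := fun r hr =>
      List.map_inj_left.1 (TFNP.encList_injective hdict) r (List.mem_range.2 hr)
    have hatt : ∀ j : Fin (gg m), attOf (codeOf G₂) (τ.toEquiv j) = attOf (codeOf G₁) j := fun j => by
      rw [← lookupFam_rankFam hlen₂ (τ.toEquiv j).2, ← lookupFam_rankFam hlen₁ j.2, hlook _ (rankFam_lt j.2)]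
      exact congrArg _ (hrk j)
    exact budget_of_transfer τ.toEquiv ((fixedFn_codeOf_eq_iff G₁ G₂).1 hfix) hatt hiso
  · rintro ⟨ρ, hρ, hG⟩
    obtain ⟨hfix, σ, hσa, hσi⟩ := transfer_of_budget ρ hρ hG
    have hσa' : ∀ j : Fin (gg m), attOf (codeOf G₂) (σ.symm j) = attOf (codeOf G₁) j := fun j => by
      rw [hσa, Equiv.apply_symm_apply]
    have hd : dictFn (codeOf G₁) = dictFn (codeOf G₂) := by
      rw [dictFn_codeOf, dictFn_codeOf]
      exact congrArg encList (List.map_congr_left fun r _ => (lookupFam_perm σ.symm hσa' hlen₁ r).symm)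
    rw [(fixedFn_codeOf_eq_iff G₁ G₂).2 hfix, hd, extractFn_codeOf, extractFn_codeOf]
    congr 1
    refine h₂ (gg m) (freeG G₁) (rkOf G₁) (freeG G₂) (rkOf G₂) ⟨⟨σ.symm, fun {a b} => ?_⟩, fun v => ?_⟩
    · have := hσi (σ.symm a) (σ.symm b)
      rw [Equiv.apply_symm_apply, Equiv.apply_symm_apply] at this
      exact this
    · exact rankFam_perm σ.symm hσa' v

/-- The relabelled matrix graph is the pull-back: `Gr (x ∘ ρ×ρ) = Gr y ↔ ∀ u v, (Gr y).Adj u v ↔ (Gr x).Adj (ρ u) (ρ v)`. -/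
theorem fromRel_perm_eq_iff (x y : Fin m × Fin m → Bool) (ρ : Equiv.Perm (Fin m)) :
    (SimpleGraph.fromRel fun u v => x (ρ u, ρ v) = true) = (SimpleGraph.fromRel fun u v => y (u, v) = true) ↔
      ∀ u v, (SimpleGraph.fromRel fun u v => y (u, v) = true).Adj u v ↔
        (SimpleGraph.fromRel fun u v => x (u, v) = true).Adj (ρ u) (ρ v) := by
  have key : ∀ u v, (SimpleGraph.fromRel fun u v => x (ρ u, ρ v) = true).Adj u v ↔
      (SimpleGraph.fromRel fun u v => x (u, v) = true).Adj (ρ u) (ρ v) := fun u v => by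
    simp only [SimpleGraph.fromRel_adj, ne_eq, EmbeddingLike.apply_eq_iff_eq]
  constructor
  · intro h u v; rw [← h]; exact key u v
  · intro h; ext u v; rw [key, h]

end CompleteInvariant

/-- **S1b — from canonical forms of small coloured graphs to a polynomial-time complete invariant for
`Bud`-isomorphism.** Given a canoniser `can ∈ FTIME (N ↦ 2^{c√N})` of vertex-coloured graphs (canonical
form colour-isomorphic to the input, equal on colour-isomorphic inputs), the map `invFn can` is in `FP` and,
for every `m` and all `m × m` Boolean matrices `x, y`, takes equal values on the codes of `Gr x`, `Gr y` iff
some `ρ ∈ pointStabiliserBudget m ⌊log₂ m⌋` carries `Gr x` onto `Gr y`. (`m₀ = 0`.) -/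
theorem stub_completeInvariantFP_of_canonicalForm :
    (∃ c : ℕ, ∃ can ∈ FTIME (fun N => 2 ^ (c * Nat.sqrt N)),
      (∀ (k : ℕ) (G : SimpleGraph (Fin k)) (col : Fin k → ℕ),
          ∃ (G' : SimpleGraph (Fin k)) (col' : Fin k → ℕ),
            can (boolPair (encodingGraph.encode ⟨k, G⟩)
                  ((encodingFinVec Computability.encodingNatBool k).encode col)) =
                boolPair (encodingGraph.encode ⟨k, G'⟩)
                  ((encodingFinVec Computability.encodingNatBool k).encode col') ∧
              ∃ σ : G ≃g G', ∀ v : Fin k, col' (σ v) = col v) ∧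
      ∀ (k : ℕ) (G₁ : SimpleGraph (Fin k)) (c₁ : Fin k → ℕ) (G₂ : SimpleGraph (Fin k))
        (c₂ : Fin k → ℕ), (∃ σ : G₁ ≃g G₂, ∀ v : Fin k, c₂ (σ v) = c₁ v) →
          can (boolPair (encodingGraph.encode ⟨k, G₁⟩)
                ((encodingFinVec Computability.encodingNatBool k).encode c₁)) =
            can (boolPair (encodingGraph.encode ⟨k, G₂⟩)
                ((encodingFinVec Computability.encodingNatBool k).encode c₂))) →
    ∃ F ∈ FP, ∃ m₀ : ℕ, ∀ m : ℕ, m₀ ≤ m → ∀ x y : Fin m × Fin m → Bool,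
      (F (encodingGraph.encode ⟨m, SimpleGraph.fromRel fun u v => x (u, v) = true⟩) =
          F (encodingGraph.encode ⟨m, SimpleGraph.fromRel fun u v => y (u, v) = true⟩) ↔
        ∃ ρ ∈ pointStabiliserBudget m (Nat.log 2 m),
          (SimpleGraph.fromRel fun u v => x (ρ u, ρ v) = true) =
            (SimpleGraph.fromRel fun u v => y (u, v) = true)) := by
  rintro ⟨c, can, hcan, h₁, h₂⟩
  refine ⟨invFn can, invFn_mem_FP hcan, 0, fun m _ x y => ?_⟩
  rw [CompleteInvariant.invFn_codeOf_eq_iff h₁ h₂]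
  refine exists_congr fun ρ => and_congr_right fun _ => ?_
  rw [CompleteInvariant.fromRel_perm_eq_iff]

end Summit.PneNP.PneNP.Theorems
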